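import Literature.Geometry.Riemannian.ConeRadialIsometry
import Literature.Geometry.Riemannian.ExpMapDifferential
import HarnessLib

/-!
# The tube map of a framed curve: value and differential at the core

Topic `Geometry/Riemannian`. For a curve `c : ℝ → M` and a frame `e : ℝ → (V →L[ℝ] E)` along it
(`e t : V → T_{c t}M`, `V` a real inner product space with a distinguished unit vector `ε₀`), the
**tube map** (Fermi coordinates of the curve, Lee 2018, pp. 143–144, Prop. 5.26; Gray, *Tubes*)

  `Φ(v) = exp_{c(ℓ v)}(e(ℓ v)(v - (ℓ v) ε₀))`,  `ℓ v = ⟪ε₀, v⟫`,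

sends the axis `ℝ ε₀` to the curve and the affine normal slices `x₁ ε₀ + ε₀^⊥` to the
exponentiated images of the frame. For a geodesically complete `C^∞` covariant derivative and a
frame with `(t, w) ↦ (c t, e t w) ∈ TM` jointly `C^∞`:

* `contMDiff_tubeMap` — `Φ` is `C^∞` on `V`;
* `tubeMap_axis` — `Φ(x₁ ε₀) = c x₁`;
* `mfderiv_tubeMap_axis_apply_unit`, `mfderiv_tubeMap_axis_apply_of_inner_eq_zero`,
  `mfderiv_tubeMap_axis_apply` — **on the axis `dΦ_{x₁ε₀} = e(x₁)`** when the frame is adapted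
  (`e t ε₀ = c'(t)`): radially `dΦ(ε₀) = c'(x₁)` (the axis is mapped to the curve), normally
  `dΦ(u) = e(x₁) u` for `u ⊥ ε₀` (`d(exp_y)_0 = id` along the ray `s ↦ exp_y(s e u)`), and in
  general by linearity;
* `val_mfderiv_tubeMap_axis` — hence for a `g`-orthonormal frame the pulled-back metric is the
  inner product of `V` on the axis, `g(dΦ u, dΦ w) = ⟪u, w⟫` (Lee 2018, Prop. 5.26 (b)/(c) for Fermi
  coordinates: `g_{ij} = δ_{ij}` on the submanifold), and `dΦ_{x₁ε₀}` is injective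
  (`injective_mfderiv_tubeMap_axis`).

This is the first layer of the tube around Weinstein's dense arc (Weinstein 1968, proof of the
main theorem, step (2)): the disk `D` is the image under `Φ` of a thin ellipsoid around the axis.

## References

* J. M. Lee, *Introduction to Riemannian Manifolds*, 2nd ed., Springer GTM 176 (2018), pp. 143–144
  (Fermi coordinates), Prop. 5.26. [cite: LeeRiemannianManifolds2018, Prop. 5.26]
* A. Gray, *Tubes*, 2nd ed., Birkhäuser (2004), §2.1.
* A. Weinstein, Ann. of Math. (2) 87 (1968), 29–41. [cite: Weinstein1968]

Tags: [FermiCoordinates] [TubeMap] [Weinstein1968]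
-/

noncomputable section

open Bundle Set Filter Function
open scoped Manifold ContDiff Topology RealInnerProductSpace

namespace Literature.Geometry.Riemannian

open Literature.Geometry.Lorentzian
open Literature.Geometry.Lorentzian.PseudoRiemannianMetric

variable {V : Type*} [NormedAddCommGroup V] [InnerProductSpace ℝ V]
  {E : Type*} [NormedAddCommGroup E] [NormedSpace ℝ E] {H : Type*} [TopologicalSpace H]
  {I : ModelWithCorners ℝ E H} {M : Type*} [TopologicalSpace M] [ChartedSpace H M]
  [IsManifold I ∞ M] [FiniteDimensional ℝ E] [CompleteSpace E] [T2Space M] [BoundarylessManifold I M]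
  {cov : CovariantDerivative I E (TangentSpace I : M → Type _)}
  [CovariantDerivative.ContMDiffCovariantDerivative cov 1]
  [CovariantDerivative.ContMDiffCovariantDerivative cov ((⊤ : ℕ∞) : ℕ∞ω)]
  {c : ℝ → M} {e : Π t : ℝ, V →L[ℝ] TangentSpace I (c t)} {ε₀ : V}

/-! ### Algebra of the axis `ℝ ε₀` -/

omit [NormedAddCommGroup E] [NormedSpace ℝ E] [TopologicalSpace H] [TopologicalSpace M]
  [ChartedSpace H M] [IsManifold I ∞ M] [FiniteDimensional ℝ E] [CompleteSpace E] [T2Space M]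
  [BoundarylessManifold I M] [CovariantDerivative.ContMDiffCovariantDerivative cov 1]
  [CovariantDerivative.ContMDiffCovariantDerivative cov ((⊤ : ℕ∞) : ℕ∞ω)] in
/-- `⟪ε₀, x₁ ε₀⟫ = x₁` for a unit vector. [folklore] -/
theorem inner_smul_unit_self (hε₀ : ‖ε₀‖ = 1) (x₁ : ℝ) : ⟪ε₀, x₁ • ε₀⟫ = x₁ := by
  rw [inner_smul_right, real_inner_self_eq_norm_sq, hε₀, one_pow, mul_one]

omit [NormedAddCommGroup E] [NormedSpace ℝ E] [TopologicalSpace H] [TopologicalSpace M]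
  [ChartedSpace H M] [IsManifold I ∞ M] [FiniteDimensional ℝ E] [CompleteSpace E] [T2Space M]
  [BoundarylessManifold I M] [CovariantDerivative.ContMDiffCovariantDerivative cov 1]
  [CovariantDerivative.ContMDiffCovariantDerivative cov ((⊤ : ℕ∞) : ℕ∞ω)] in
/-- `⟪ε₀, x₁ ε₀ + s u⟫ = x₁` for a unit `ε₀` and `u ⊥ ε₀`. [folklore] -/
theorem inner_smul_unit_add (hε₀ : ‖ε₀‖ = 1) {u : V} (hu : ⟪ε₀, u⟫ = 0) (x₁ s : ℝ) :
    ⟪ε₀, x₁ • ε₀ + s • u⟫ = x₁ := by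
  rw [inner_add_right, inner_smul_unit_self hε₀, inner_smul_right, hu, mul_zero, add_zero]

/-! ### Smoothness of the tube map -/

/-- **The tube map is `C^∞`** for a geodesically complete `C^∞` covariant derivative and a frame
with `(t, w) ↦ (c t, e t w) ∈ TM` jointly `C^∞`: `exp` is `C^∞` on `TM = 𝓔`
(`contMDiffOn_expMap_totalSpace`) and `v ↦ (c(ℓ v), e(ℓ v)(v - (ℓ v)ε₀))` is the composition of the
frame with the smooth map `v ↦ (ℓ v, v - (ℓ v) ε₀)`. [cite: LeeRiemannianManifolds2018, Prop. 5.19] -/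
theorem contMDiff_tubeMap (hc : IsGeodesicallyComplete cov)
    (hs : ContMDiff (𝓘(ℝ, ℝ).prod 𝓘(ℝ, V)) I.tangent ∞
      (fun q : ℝ × V ↦ (TotalSpace.mk' E (c q.1) (e q.1 q.2) : TangentBundle I M))) :
    ContMDiff 𝓘(ℝ, V) I ∞ (fun v : V ↦ expMap cov (c ⟪ε₀, v⟫) (e ⟪ε₀, v⟫ (v - ⟪ε₀, v⟫ • ε₀))) := by
  have hA : ContMDiff 𝓘(ℝ, V) (𝓘(ℝ, ℝ).prod 𝓘(ℝ, V)) ∞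
      (fun v : V ↦ ((⟪ε₀, v⟫, v - ⟪ε₀, v⟫ • ε₀) : ℝ × V)) := by
    have h1 : ContDiff ℝ ∞ fun v : V ↦ ⟪ε₀, v⟫ := contDiff_const.inner ℝ contDiff_id
    have h2 : ContDiff ℝ ∞ fun v : V ↦ v - ⟪ε₀, v⟫ • ε₀ := contDiff_id.sub (h1.smul contDiff_const)
    exact h1.contMDiff.prodMk h2.contMDiff
  have hB := hs.comp hA
  have hexp := contMDiffOn_expMap_totalSpace (cov := cov) (k := (⊤ : ℕ∞)) le_top
  have hdom : ∀ v : V, ((fun q : ℝ × V ↦ (TotalSpace.mk' E (c q.1) (e q.1 q.2) : TangentBundle I M)) ∘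
        (fun v : V ↦ ((⟪ε₀, v⟫, v - ⟪ε₀, v⟫ • ε₀) : ℝ × V))) v ∈
      {p : TangentBundle I M | (1 : ℝ) ∈ maximalGeodesicDomain cov p.proj p.2} := fun v ↦ by
    show (1 : ℝ) ∈ maximalGeodesicDomain cov (c ⟪ε₀, v⟫) _
    rw [(maximalGeodesic_of_isGeodesicallyComplete hc _ _).1]
    exact mem_univ _
  exact hexp.comp_contMDiff hB hdom

/-! ### The axis is mapped to the curve -/

omit [CovariantDerivative.ContMDiffCovariantDerivative cov ((⊤ : ℕ∞) : ℕ∞ω)] in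
/-- **`Φ(x₁ ε₀) = c(x₁)`**: on the axis the normal part vanishes and `exp_y 0 = y`. [folklore] -/
theorem tubeMap_axis (hε₀ : ‖ε₀‖ = 1) (x₁ : ℝ) :
    expMap cov (c ⟪ε₀, x₁ • ε₀⟫) (e ⟪ε₀, x₁ • ε₀⟫ (x₁ • ε₀ - ⟪ε₀, x₁ • ε₀⟫ • ε₀)) = c x₁ := by
  rw [inner_smul_unit_self hε₀, sub_self, map_zero]
  exact expMap_zero (cov := cov) (c x₁)

/-! ### The differential on the axis -/

/-- **Radial direction: `dΦ_{x₁ε₀}(ε₀) = c'(x₁)`** — the axis is mapped onto the curve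
(`Φ((x₁ + s)ε₀) = c(x₁ + s)`, chain rule). [cite: LeeRiemannianManifolds2018, Prop. 5.26] -/
theorem mfderiv_tubeMap_axis_apply_unit (hc : IsGeodesicallyComplete cov)
    (hs : ContMDiff (𝓘(ℝ, ℝ).prod 𝓘(ℝ, V)) I.tangent ∞
      (fun q : ℝ × V ↦ (TotalSpace.mk' E (c q.1) (e q.1 q.2) : TangentBundle I M)))
    (hε₀ : ‖ε₀‖ = 1) (x₁ : ℝ) :
    mfderiv 𝓘(ℝ, V) I (fun v : V ↦ expMap cov (c ⟪ε₀, v⟫) (e ⟪ε₀, v⟫ (v - ⟪ε₀, v⟫ • ε₀))) (x₁ • ε₀) ε₀ =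
      (velocity I c x₁ : E) := by
  set Φ : V → M := fun v : V ↦ expMap cov (c ⟪ε₀, v⟫) (e ⟪ε₀, v⟫ (v - ⟪ε₀, v⟫ • ε₀)) with hΦ
  have hΦd : MDifferentiableAt 𝓘(ℝ, V) I Φ (x₁ • ε₀) :=
    ((contMDiff_tubeMap (cov := cov) hc hs) _).mdifferentiableAt (by simp)
  -- chain rule along the axis curve `s ↦ (x₁ + s) ε₀`
  have hcurve : HasDerivAt (fun s : ℝ ↦ (x₁ + s) • ε₀) ε₀ 0 := by
    have h := ((hasDerivAt_id (0 : ℝ)).const_add x₁).smul_const ε₀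
    simpa using h
  have h1 : velocity I (Φ ∘ fun s : ℝ ↦ (x₁ + s) • ε₀) 0 = mfderiv 𝓘(ℝ, V) I Φ (x₁ • ε₀) ε₀ :=
    velocity_comp_of_hasDerivAt_normedSpace (F := Φ) (c := fun s : ℝ ↦ (x₁ + s) • ε₀) (t := 0)
      (w := x₁ • ε₀) (by simp) hΦd hcurve
  -- along the axis `Φ` is the curve
  have h2 : (Φ ∘ fun s : ℝ ↦ (x₁ + s) • ε₀) = fun s : ℝ ↦ c (1 * s + x₁) := by
    funext s
    simp only [comp_apply, hΦ]
    rw [inner_smul_unit_self hε₀, sub_self, map_zero]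
    rw [expMap_zero (cov := cov) (c (x₁ + s))]
    congr 1
    ring
  rw [← h1, h2, velocity_comp_affine c 1 x₁ 0, one_smul]
  have key : ∀ t : ℝ, t = x₁ → (velocity I c t : E) = velocity I c x₁ := by
    rintro t rfl
    rfl
  exact key _ (by ring)

/-- **Normal directions: `dΦ_{x₁ε₀}(u) = e(x₁) u` for `u ⊥ ε₀`** — along `s ↦ x₁ε₀ + su` the tube
map is the geodesic `s ↦ exp_{c x₁}(s e(x₁) u)`, whose initial velocity is `e(x₁) u`
(`velocity_expMap_smul_zero`). [cite: LeeRiemannianManifolds2018, Prop. 5.26] -/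
theorem mfderiv_tubeMap_axis_apply_of_inner_eq_zero (hc : IsGeodesicallyComplete cov)
    (hs : ContMDiff (𝓘(ℝ, ℝ).prod 𝓘(ℝ, V)) I.tangent ∞
      (fun q : ℝ × V ↦ (TotalSpace.mk' E (c q.1) (e q.1 q.2) : TangentBundle I M)))
    (hε₀ : ‖ε₀‖ = 1) (x₁ : ℝ) {u : V} (hu : ⟪ε₀, u⟫ = 0) :
    mfderiv 𝓘(ℝ, V) I (fun v : V ↦ expMap cov (c ⟪ε₀, v⟫) (e ⟪ε₀, v⟫ (v - ⟪ε₀, v⟫ • ε₀))) (x₁ • ε₀) u =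
      e x₁ u := by
  set Φ : V → M := fun v : V ↦ expMap cov (c ⟪ε₀, v⟫) (e ⟪ε₀, v⟫ (v - ⟪ε₀, v⟫ • ε₀)) with hΦ
  have hΦd : MDifferentiableAt 𝓘(ℝ, V) I Φ (x₁ • ε₀) :=
    ((contMDiff_tubeMap (cov := cov) hc hs) _).mdifferentiableAt (by simp)
  have h1 : velocity I (fun s : ℝ ↦ Φ (x₁ • ε₀ + s • u)) 0 = mfderiv 𝓘(ℝ, V) I Φ (x₁ • ε₀) u :=
    velocity_comp_lineAt_zero hΦd u
  have h2 : (fun s : ℝ ↦ Φ (x₁ • ε₀ + s • u)) =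
      fun s : ℝ ↦ expMap cov (c x₁) (s • e x₁ u) := by
    funext s
    simp only [hΦ]
    rw [inner_smul_unit_add hε₀ hu, add_sub_cancel_left, map_smul]
  rw [← h1, h2]
  exact velocity_expMap_smul_zero (cov := cov) (c x₁) _

/-- **On the axis `dΦ_{x₁ε₀} = e(x₁)`** for an adapted frame (`e t ε₀ = c'(t)`): decompose
`w = ⟪ε₀, w⟫ ε₀ + (w - ⟪ε₀, w⟫ ε₀)` and use the radial and normal cases and linearity.
[cite: LeeRiemannianManifolds2018, Prop. 5.26] -/
theorem mfderiv_tubeMap_axis_apply (hc : IsGeodesicallyComplete cov)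
    (hs : ContMDiff (𝓘(ℝ, ℝ).prod 𝓘(ℝ, V)) I.tangent ∞
      (fun q : ℝ × V ↦ (TotalSpace.mk' E (c q.1) (e q.1 q.2) : TangentBundle I M)))
    (hε₀ : ‖ε₀‖ = 1) (he₀ : ∀ t, e t ε₀ = (velocity I c t : E)) (x₁ : ℝ) (w : V) :
    mfderiv 𝓘(ℝ, V) I (fun v : V ↦ expMap cov (c ⟪ε₀, v⟫) (e ⟪ε₀, v⟫ (v - ⟪ε₀, v⟫ • ε₀))) (x₁ • ε₀) w =
      e x₁ w := by
  set Φ : V → M := fun v : V ↦ expMap cov (c ⟪ε₀, v⟫) (e ⟪ε₀, v⟫ (v - ⟪ε₀, v⟫ • ε₀)) with hΦ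
  have hperp : ⟪ε₀, w - ⟪ε₀, w⟫ • ε₀⟫ = 0 := by
    rw [inner_sub_right, inner_smul_unit_self hε₀, sub_self]
  have hrad := mfderiv_tubeMap_axis_apply_unit (cov := cov) hc hs hε₀ x₁
  have hnor := mfderiv_tubeMap_axis_apply_of_inner_eq_zero (cov := cov) hc hs hε₀ x₁ hperp
  have hdec : w = ⟪ε₀, w⟫ • ε₀ + (w - ⟪ε₀, w⟫ • ε₀) := by abel
  have ea : mfderiv 𝓘(ℝ, V) I Φ (x₁ • ε₀) (⟪ε₀, w⟫ • ε₀ + (w - ⟪ε₀, w⟫ • ε₀) : V) =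
      mfderiv 𝓘(ℝ, V) I Φ (x₁ • ε₀) (⟪ε₀, w⟫ • ε₀ : V) +
        mfderiv 𝓘(ℝ, V) I Φ (x₁ • ε₀) (w - ⟪ε₀, w⟫ • ε₀) :=
    (mfderiv 𝓘(ℝ, V) I Φ (x₁ • ε₀)).map_add _ _
  have eb : mfderiv 𝓘(ℝ, V) I Φ (x₁ • ε₀) (⟪ε₀, w⟫ • ε₀ : V) =
      ⟪ε₀, w⟫ • mfderiv 𝓘(ℝ, V) I Φ (x₁ • ε₀) ε₀ :=
    (mfderiv 𝓘(ℝ, V) I Φ (x₁ • ε₀)).map_smul _ _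
  have key : ∀ w' : V, w' = ⟪ε₀, w⟫ • ε₀ + (w - ⟪ε₀, w⟫ • ε₀) →
      mfderiv 𝓘(ℝ, V) I Φ (x₁ • ε₀) w' = e x₁ w' := by
    rintro w' rfl
    rw [ea, eb, map_add, map_smul, he₀ x₁]
    show ⟪ε₀, w⟫ • mfderiv 𝓘(ℝ, V) I Φ (x₁ • ε₀) ε₀ +
        mfderiv 𝓘(ℝ, V) I Φ (x₁ • ε₀) (w - ⟪ε₀, w⟫ • ε₀) =
      ⟪ε₀, w⟫ • (velocity I c x₁ : E) + e x₁ (w - ⟪ε₀, w⟫ • ε₀)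
    rw [hrad, hnor]
    rfl
  exact key w hdec

/-! ### Metric consequences for an orthonormal adapted frame -/

variable {n : ℕ∞ω} [Fact (1 ≤ n)]
  (g : PseudoRiemannianMetric I n E (TangentSpace I : M → Type _)) [g.HasLeviCivita]
  [CovariantDerivative.ContMDiffCovariantDerivative g.leviCivita 1]
  [CovariantDerivative.ContMDiffCovariantDerivative g.leviCivita ((⊤ : ℕ∞) : ℕ∞ω)]

omit [CovariantDerivative.ContMDiffCovariantDerivative cov 1]
  [CovariantDerivative.ContMDiffCovariantDerivative cov ((⊤ : ℕ∞) : ℕ∞ω)] [Fact (1 ≤ n)] in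
/-- **On the axis the pulled-back metric is the inner product**: for a `g`-orthonormal adapted
frame, `g(dΦ_{x₁ε₀} u, dΦ_{x₁ε₀} w) = ⟪u, w⟫` (Lee 2018, Prop. 5.26 (b): in Fermi coordinates the
metric is `δ` on the submanifold). [cite: LeeRiemannianManifolds2018, Prop. 5.26] -/
theorem val_mfderiv_tubeMap_axis (hgc : IsGeodesicallyComplete g.leviCivita)
    (hs : ContMDiff (𝓘(ℝ, ℝ).prod 𝓘(ℝ, V)) I.tangent ∞
      (fun q : ℝ × V ↦ (TotalSpace.mk' E (c q.1) (e q.1 q.2) : TangentBundle I M)))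
    (hε₀ : ‖ε₀‖ = 1) (he₀ : ∀ t, e t ε₀ = (velocity I c t : E))
    (hiso : ∀ t (u w : V), g.val (c t) (e t u) (e t w) = ⟪u, w⟫) (x₁ : ℝ) (u w : V) :
    g.val (c x₁)
      (mfderiv 𝓘(ℝ, V) I (fun v : V ↦ expMap g.leviCivita (c ⟪ε₀, v⟫) (e ⟪ε₀, v⟫ (v - ⟪ε₀, v⟫ • ε₀))) (x₁ • ε₀) u)
      (mfderiv 𝓘(ℝ, V) I (fun v : V ↦ expMap g.leviCivita (c ⟪ε₀, v⟫) (e ⟪ε₀, v⟫ (v - ⟪ε₀, v⟫ • ε₀))) (x₁ • ε₀) w) =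
      ⟪u, w⟫ := by
  rw [mfderiv_tubeMap_axis_apply (cov := g.leviCivita) hgc hs hε₀ he₀,
    mfderiv_tubeMap_axis_apply (cov := g.leviCivita) hgc hs hε₀ he₀, hiso]

omit [CovariantDerivative.ContMDiffCovariantDerivative cov 1]
  [CovariantDerivative.ContMDiffCovariantDerivative cov ((⊤ : ℕ∞) : ℕ∞ω)] [Fact (1 ≤ n)] in
/-- **On the axis `dΦ` is injective** for a `g`-orthonormal adapted frame (an isometry onto its
image). [cite: LeeRiemannianManifolds2018, Prop. 5.26] -/
theorem injective_mfderiv_tubeMap_axis (hgc : IsGeodesicallyComplete g.leviCivita)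
    (hs : ContMDiff (𝓘(ℝ, ℝ).prod 𝓘(ℝ, V)) I.tangent ∞
      (fun q : ℝ × V ↦ (TotalSpace.mk' E (c q.1) (e q.1 q.2) : TangentBundle I M)))
    (hε₀ : ‖ε₀‖ = 1) (he₀ : ∀ t, e t ε₀ = (velocity I c t : E))
    (hiso : ∀ t (u w : V), g.val (c t) (e t u) (e t w) = ⟪u, w⟫) (x₁ : ℝ) :
    Injective (mfderiv 𝓘(ℝ, V) I (fun v : V ↦ expMap g.leviCivita (c ⟪ε₀, v⟫) (e ⟪ε₀, v⟫ (v - ⟪ε₀, v⟫ • ε₀))) (x₁ • ε₀)) := by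
  rw [injective_iff_map_eq_zero]
  intro u hu
  change V at u
  -- `dΦ u = e(x₁) u`, so `e(x₁) u = 0` and `⟪u, u⟫ = g(e u, e u) = 0`
  have h1 : e x₁ u = 0 := by
    rw [← mfderiv_tubeMap_axis_apply (cov := g.leviCivita) hgc hs hε₀ he₀ x₁ u]
    exact hu
  have h2 : ⟪u, u⟫ = 0 := by
    rw [← hiso x₁ u u, h1]
    simp
  exact inner_self_eq_zero.1 h2

end Literature.Geometry.Riemannian

end
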